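import Literature.MathematicalPhysics.QuantumFieldTheory.Balaban1983to89.B12NodeKnitRecord11

/-!
# NODE N09 · [Balaban1987RG1] — THE NAMED COMPOSITION INPUT `HInvT` AT THE RECORD'S TRANSPORT HOLDS WITH NO PROVISO; N09's Theorem-3
# member at the Stage-10 ∕ Stage-11 CORES reads NOTHING of NODE 00's analytic provisos

T. Bałaban, *Renormalization group approach to lattice gauge field theories. I*, Commun. Math. Phys. **109** (1987) 249–301 [Balaban1987RG1] (= [I];
(0.13) p. 254, (0.19) p. 255, (0.21)–(0.23) p. 256, p. 263, (2.16) p. 269, Thm 3 p. 264); [Balaban1985Variational] (= [B11], CMP **102** (1985)) Thm 1 p. 279.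
TRACK A (YM-PLAN §2b, node N09 of 28), seat `pub-ymgap-dag-n09-e` (prover; director-ym R141 (C) WIDER STRATEGY FAN-OUT, strategy s3 «NAMED-`HInv`
CURRENCY»; HUMAN RULINGS D-0062 ∕ D-0064 ∕ D-0088).  THEOREMS ONLY, def-free, sorry-free, standard axioms.  Successor (by import, nothing edited) of
seat dag-n09-a's MODULES 1–2 (`B12ContinuousTransportInvariance`, `B12NodeKnitContinuousTransport`), MODULE 3 (`B12NodeKnitRecord10`) and seat dag-n09-d's
MODULE 3′ (`B12NodeKnitRecord11`).

THE ROW AND ITS STATE.  N09's share of the Theorem-3 member (conjunct 2 of `Dag.B12_main`) was isolated by node00-def-B as the NAMED Prop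
`Node00.HInvT T χ K g k` (`Node00/BackgroundActionT`: invariance of `A_j ∘ Ū^j`, `j < k`, under the residual group of level `j+1` — [I] (0.21) p. 256 «invariant
with respect to the gauge transformations u … u = 1 on T⁽ᵏ⁾», (0.24) p. 257 «gauge invariant functions of U»), with `HOrbit ∧ HInvT ⇒ HCompT ⇒ (0.23)∕(1.3) at the
record` (`hCompT_of_hOrbit_of_hInvT`, `indAOfRecordT_atRecord`).  Over Stage 5's Radon–Nikodym transport `TOfRecord` point values of `HInvT` are unknowable; since
node00-def-T's `Record10` the record reads the actions through the CONTINUOUS-VERSION transport `Node00.TcOfRecord`, over which MODULES 1–2 proved `HInvT`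
MODULO the record's displayed proviso `Stage8Params.HasContTransportAlong` (`Provisos₁₀.contT`, `Provisos₁₁.base.contT`): the (0.19) densities met have CONTINUOUS
transforms of record.  So at ₁₀C∕₁₁C no `HInv` binder is displayed (`B12NodeKnitRecord10∕11`), the proviso standing behind it.

WHAT THIS FILE PROVES — THE PROVISO IS IDLE FOR N09.  `TcOfRecord K k ρ` is `Node00.contVersion` of the kernel transform: the continuous function in its
a.e.-class when there is one, and the DOCUMENTED JUNK VALUE `0` otherwise (`Node00.contVersion_of_not`).  The zero density is gauge invariant.  Hence the
per-step mapping property MODULE 1's induction consumes — «`LiftInvariant ρ_j → GaugeInvariant (TcOfRecord K j ρ_j)` at the (0.19) density `ρ_j` met at step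
`j < K`» — holds at EVERY step with NO hypothesis: where a continuous transform exists by MODULE 2's `stepInvariant_TcOfRecord` (p. 254 pointwise for continuous
images), where none exists by the junk branch (§1–§2).  Consequently (all WITHOUT `HasContTransportAt ∕ …Alongβ ∕ …Along`):
* §2 `gaugeInvariant_effActionHT_TcOfRecord_unconditional` (p. 263 at the β re-point of record, every `k ≤ K`), **`hInvT_TcOfRecord_unconditional`** (the NAMED
  `HInvT (TcOfRecord F N) (chiFixed7 F N ν) K g k`, every `ν K g`, `k ≤ K` — DISCHARGED OUTRIGHT, not displayed, not modulo a proviso),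
  `hCompT_TcOfRecord_of_hRestrict` (`HCompT` ⇐ `HRestrict` + (1.1)-uniqueness at the intermediate levels ALONE), `indAOfRecordT_atRecord_TcOfRecord_of_hRestrict`;
* §3 the stage-free plug `thm3Member_of_indATPlug_TcOfRecord_unconditional` = MODULE 2 §5's plug MINUS its `hex` binder, and `b12_main_…`;
* §4 N09's member for a world bound to the PROVISO-FREE CORES `(coreOfRecord₁₀ θ).construction (densOfRecord₁₀ θ)` ∕ `(coreOfRecord₁₁ θ).construction
  (densOfRecord₁₀ θ.toStage9Params)` (the right-hand sides of `datumOfRecord₁₀_C` ∕ `datumOfRecord₁₁_C`): `thm3Member_core10_of_hRestrict`, **`thm3Member_core11_of_hRestrict`**,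
  `b12_main_core11_of_leaf_of_hRestrict`, `b12_main_core11_iff_leaf_of_hRestrict` — the statements carry NO `Provisos₁₀ ∕ Provisos₁₁`; the displayed binders are
  EXACTLY seat dag-n09-d's `h11 ∕ hres ∕ huniq` ([B11] Thm 1 at the record's level domains — N07's content); dag-n09-d's `thm3Member_at_record₁₁C_of_hRestrict` at
  `IsRecordOfRecord₁₁C` is the instance through `datumOfRecord₁₁_C` (cited, not restated);
* §5 NON-VACUITY of the remaining binder family (referee rule (R2)): on every ONE-STEP run (`P.K = 0`) of every Stage-11 parameter in the numeric window
  `θ.ν.ε₀ ≤ θ.εbg` the binders HOLD (`h11_level_zero_of_window` by `ukExists_zero_iff` ∕ `uniqueUkOrbit_zero`; `hRestrict_zero`, `huniq_zero` vacuous) and the member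
  holds OUTRIGHT (`thm3Member_core11_of_K_eq_zero`) — the implication is not ex falso.
LOCATED REMARK (§1 `effActionHT_succ_eq_zero_of_not`): where the proviso fails at step `k`, the record's `A_{k+1} = log(𝐍_k⁻¹·0)` IS the junk zero density; N09's
member — a FORMAT predicate ((1.1) clauses ∧ the (0.22)∕(0.23) telescoping, located divergence D-defB-2 «IndA = format») — does not distinguish the genuine branch
(print's (0.21)) from the junk one.  `contT` stays load-bearing for the β-layer's VALUES (`betaOfRecord₁₀` reads `TcOfRecord`) and for K0 (`Record11Inhabited`,
stmt-QuantumFields-19673); it is NOT read by N09's member.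
HONEST FRAMING: count-neutral kernel bookkeeping + one junk-robustness observation about the typed transport; nothing of Bałaban's asserted; no estimate; N09 NOT
discharged (conjunct 1's B12-group pin and N07's [B11] inputs are binders; record inhabitation is K0); one finite four-torus programme at fixed ε per run — NOT ℝ⁴,
NOT infinite volume, NOT OS axioms, NOT a mass gap, NOT the Clay problem.  Filed `--supports` K1 `StabilityBAtRecordR11e` (stmt-QuantumFields-19674).
-/

noncomputable section

namespace Literature.MathematicalPhysics.QuantumFieldTheory.Balaban1983to89.B12HInvUnconditional

open MeasureTheory
open DagBinding Node00 T4Continuum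
open FlowStep (HBeta prefixOf RGEqH)
open FlowStepRuns (genSeq genFlow)
open T4FlagMemory (extd)
open B12Eq019ActionBody (integrand nextAction_apply)
open B12RTGaugeInvariance254 (LiftInvariant)
open GaugeField (GaugeInvariant gaugeAct)
open B12NodeKnitRecord8 (b12_main_of_leaf_of_thm3Member b12_main_iff_leaf_of_thm3Member uniqueUkOrbit_zero)
open B12ContinuousTransportInvariance (gaugeInvariant_effActionHT_of_steps hInvT_of_steps hCompT_of_steps indAOfRecordT_atRecord_of_steps
  thm3Member_of_indATPlug_of_steps)
open B12NodeKnitContinuousTransport (stepInvariant_TcOfRecord liftInvariant_chiFixed7 chiFixed7_extd_prefixOf)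

variable {F : T4Family} {N : ℕ} [NeZero N]

/-! ## §1. The junk branch of the continuous-version transport of record -/

/-- **THE JUNK BRANCH**: if the transform of record of `ρ` at step `k` of the `K`-th torus has NO continuous version, node00-def-T's continuous-version transport
returns the zero density (`TcOfRecord = contVersion …`, `contVersion_of_not`). [cite: Balaban1987RG1, (0.13) p.254 (bookkeeping: the typed transport's junk value)] -/
theorem TcOfRecord_of_not_hasContTransportAt {K k : ℕ} {ρ : Density (F.P K) k (SU N)} (h : ¬ HasContTransportAt F N K k ρ) :
    TcOfRecord F N K k ρ = 0 := by
  rw [TcOfRecord_apply]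
  exact contVersion_of_not h

/-- The zero density is gauge invariant (both sides are `0`). [folklore] -/
private theorem gaugeInvariant_of_eq_zero {P : Params} {j : ℕ} {ρ : Density P j (SU N)} (h : ρ = 0) : GaugeInvariant ρ := by
  subst h
  exact fun _ _ => rfl

/-- **LOCATED REMARK — THE RECORD'S ACTION AFTER A JUNK STEP IS THE ZERO DENSITY**: if at step `k` the (0.19) density met along `(TcOfRecord, chiFixed7 ν)` has no
continuous transform of record (the proviso `HasContTransportAlongβ` FAILS there), then `A_{k+1} = log(𝐍_k⁻¹ · (T_k ρ_k)(·)) = log(𝐍_k⁻¹ · 0) = 0` identically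
(`Real.log 0 = 0`).  N09's member holds of these junk values as of genuine ones — it is a format predicate. [cite: Balaban1987RG1, (0.19) p.255 (bookkeeping: junk branch of the typed objects)] -/
theorem effActionHT_succ_eq_zero_of_not (ν : Stage7Numerics) (K : ℕ) (g : ℕ → ℝ) {k : ℕ}
    (h : ¬ HasContTransportAlongβ F N (TcOfRecord F N) ν K g k) :
    effActionHT F N (TcOfRecord F N) (chiFixed7 F N ν) K g (k + 1) = 0 := by
  funext V
  rw [effActionHT_succ, nextAction_apply, TcOfRecord_of_not_hasContTransportAt h]
  simp

/-! ## §2. The per-step mapping property, p. 263, `HInvT`, `HCompT` and (1.3) at the record over `TcOfRecord` — WITH NO PROVISO -/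

/-- **THE PER-STEP MAPPING PROPERTY AT `TcOfRecord`, UNCONDITIONALLY** (step `k < K` of the `K`-th torus): `TcOfRecord K k` sends the (0.19) density met — if
lift-invariant — to a function gauge invariant at EVERY coarse field.  Where the density has a continuous transform of record this is MODULE 2's
`stepInvariant_TcOfRecord` (p. 254 pointwise for continuous images) with the branch condition as its `hex`; where it has none, the image is the junk `0` (§1),
invariant trivially.  NO `HasContTransportAlongβ` hypothesis. [cite: Balaban1987RG1, (0.13) p.254 and (0.19) p.255] -/
theorem stepInvariant_TcOfRecord_unconditional (ν : Stage7Numerics) (K : ℕ) (g : ℕ → ℝ) {k : ℕ} (hk : k < K) :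
    LiftInvariant (integrand (chiFixed7 F N ν K g k) (gfOfRecord F N K k) (g k) (effActionHT F N (TcOfRecord F N) (chiFixed7 F N ν) K g k)) →
      GaugeInvariant (TcOfRecord F N K k (integrand (chiFixed7 F N ν K g k) (gfOfRecord F N K k) (g k)
        (effActionHT F N (TcOfRecord F N) (chiFixed7 F N ν) K g k))) := by
  by_cases hex : HasContTransportAlongβ F N (TcOfRecord F N) ν K g k
  · exact stepInvariant_TcOfRecord ν K g hk hex
  · exact fun _ => gaugeInvariant_of_eq_zero (TcOfRecord_of_not_hasContTransportAt hex)

/-- **THE EFFECTIVE ACTIONS AT THE β RE-POINT OF RECORD ARE GAUGE INVARIANT — NO PROVISO** (p. 263 as an unconditional theorem of the typed objects): every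
`A_k = effActionHT (TcOfRecord) (chiFixed7 ν) K g k`, `k ≤ K`, satisfies `A_k(V^v) = A_k(V)` for ALL `v`, `V` (MODULE 1's induction `gaugeInvariant_effActionHT_of_steps`
fed by `stepInvariant_TcOfRecord_unconditional`; χ lift-invariant by MODULE 2 §1).  Compare MODULE 2's `gaugeInvariant_effActionHT_TcOfRecord` (same conclusion
modulo `∀ k < K, HasContTransportAlongβ …`). [cite: Balaban1987RG1, p.263 («the action A_k(U) … is gauge invariant») and (2.16) p.269] -/
theorem gaugeInvariant_effActionHT_TcOfRecord_unconditional (ν : Stage7Numerics) (K : ℕ) (g : ℕ → ℝ) :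
    ∀ k ≤ K, GaugeInvariant (effActionHT F N (TcOfRecord F N) (chiFixed7 F N ν) K g k) :=
  gaugeInvariant_effActionHT_of_steps (TcOfRecord F N) (chiFixed7 F N ν) K g (Nat.le_add_left _ _) (fun j _ => liftInvariant_chiFixed7 ν K g j)
    fun _ hj => stepInvariant_TcOfRecord_unconditional ν K g hj

/-- **THE NAMED COMPOSITION INPUT `HInvT` AT THE RECORD'S TRANSPORT — DISCHARGED OUTRIGHT**: for every numerics `ν`, torus `K`, coupling sequence `g` and level
`k ≤ K`, `Node00.HInvT F N (TcOfRecord F N) (chiFixed7 F N ν) K g k` — the residual-gauge invariance of `A_j ∘ Ū^j`, `j < k` ([I] (0.21) ∕ (2.16)) — holds with NO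
hypothesis.  MODULE 2's `hInvT_TcOfRecord` is the same modulo the continuity proviso; the proviso is idle here. [cite: Balaban1987RG1, (0.21) p.256, (0.24) p.257 and (2.16) p.269] -/
theorem hInvT_TcOfRecord_unconditional (ν : Stage7Numerics) (K : ℕ) (g : ℕ → ℝ) {k : ℕ} (hk : k ≤ K) :
    HInvT F N (TcOfRecord F N) (chiFixed7 F N ν) K g k :=
  hInvT_of_steps (TcOfRecord F N) (chiFixed7 F N ν) K g (Nat.le_add_left _ _) (fun j _ => liftInvariant_chiFixed7 ν K g j)
    (fun _ hj => stepInvariant_TcOfRecord_unconditional ν K g hj) hk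

/-- **N09's COMPOSITION INPUT `HCompT` AT THE β RE-POINT OF RECORD FROM THE [B11] INPUTS ALONE** (level `k ≤ K`, domain `dom`, background radius `ε`): `HRestrict`
([B11] Thm 1 (8)–(10): the global minimiser restricts) + (1.1)-uniqueness at the intermediate levels — and NOTHING ELSE (MODULE 1's `hCompT_of_steps` fed by
`stepInvariant_TcOfRecord_unconditional`).  MODULE 2's `hCompT_TcOfRecord` needed the proviso at the steps `< K`. [cite: Balaban1987RG1, (0.21)–(0.23) p.256, (1.1) p.260 and (2.16) p.269; Balaban1985Variational, Thm 1 (8)–(10) p.279] -/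
theorem hCompT_TcOfRecord_of_hRestrict (ν : Stage7Numerics) {ε : ℝ} (K : ℕ) (g : ℕ → ℝ) {k : ℕ} (hk : k ≤ K)
    {dom : Set (GaugeField (F.P K) k (SU N))} (hres : HRestrict F N ε K k dom)
    (huniq : ∀ V ∈ dom, ∀ j < k, UniqueUkOrbit F N K (j + 1) ε (Averaging.iter (avOfRecord F N K) (j + 1) (Uk F N K k ε V))) :
    HCompT F N (TcOfRecord F N) (chiFixed7 F N ν) ε K g k dom :=
  hCompT_of_steps (TcOfRecord F N) (chiFixed7 F N ν) K g le_rfl (fun j _ => liftInvariant_chiFixed7 ν K g j)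
    (fun _ hj => stepInvariant_TcOfRecord_unconditional ν K g hj) hk hres huniq

/-- **(1.3) ∕ (0.23) AT THE RECORD OVER `TcOfRecord` ∕ `chiFixed7` FROM THE FLOW AND THE [B11] INPUTS — NO PROVISO**: node00-def-B's `IndAOfRecordT` at the record's
own history, domain, action, background action and expansion term follows from the flow recursion (0.20) up to `k ≤ K`, (1.1) on the domain, `HRestrict` and
intermediate uniqueness (MODULE 1's `indAOfRecordT_atRecord_of_steps`; χ-locality is `rfl`).  MODULE 2's `indAOfRecordT_atRecord_TcOfRecord` minus its `hex`.
[cite: Balaban1987RG1, (1.1)–(1.3) p.260, (0.22)–(0.23) p.256, p.263 and (2.16) p.269] -/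
theorem indAOfRecordT_atRecord_TcOfRecord_of_hRestrict (ν : Stage7Numerics) (ε : ℝ) (β : HBeta) (p : B12.RunParams) (k : ℕ) (hk : k ≤ p.K)
    (dom : Set (GaugeField (F.P p.K) k (SU N)))
    (hflow : RGEqH k β (genSeq β p.g0))
    (h11 : ∀ V ∈ dom, UkExists F N p.K k ε V ∧ UniqueUkOrbit F N p.K k ε V)
    (hres : HRestrict F N ε p.K k dom)
    (huniq : ∀ V ∈ dom, ∀ j < k, UniqueUkOrbit F N p.K (j + 1) ε (Averaging.iter (avOfRecord F N p.K) (j + 1) (Uk F N p.K k ε V))) :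
    IndAOfRecordT F N (TcOfRecord F N) (chiFixed7 F N ν) ε β p k (prefixOf (genSeq β p.g0) k) dom
      (effActionOfRecordT F N (TcOfRecord F N) (chiFixed7 F N ν) β p k) (wilsonBGOfRecord F N ε p k)
      (EkOfRecordT F N (TcOfRecord F N) (chiFixed7 F N ν) ε β p k) :=
  indAOfRecordT_atRecord_of_steps (TcOfRecord F N) (chiFixed7 F N ν) ε β p k hk dom (fun j _ => liftInvariant_chiFixed7 ν p.K _ j)
    (fun _ hj => stepInvariant_TcOfRecord_unconditional ν p.K (genSeq β p.g0) (hj.trans_le hk))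
    (chiFixed7_extd_prefixOf ν p.K (genSeq β p.g0) k) hflow h11 hres huniq

/-! ## §3. The stage-free plug over `TcOfRecord` ∕ `chiFixed7` WITHOUT the proviso -/

section Plug

variable {w : WorldP} {P : B12.RunParams} (ν : Stage7Numerics) (ε : ℝ) (β : HBeta) (dom : (k : ℕ) → Set (GaugeField (F.P P.K) k (SU N)))
  (hflow : (w.C P).flow = genFlow β P.g0)
  (hind : ∀ k, k ≤ P.K → ((w.C P).IndAss k ↔
    IndAOfRecordT F N (TcOfRecord F N) (chiFixed7 F N ν) ε β P k (prefixOf (genSeq β P.g0) k) (dom k)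
      (effActionOfRecordT F N (TcOfRecord F N) (chiFixed7 F N ν) β P k) (wilsonBGOfRecord F N ε P k)
      (EkOfRecordT F N (TcOfRecord F N) (chiFixed7 F N ν) ε β P k)))

include hflow hind in
/-- **N09's THEOREM-3 MEMBER AT THE β RE-POINT OF RECORD FROM [B11] THM 1 ALONE — NO PROVISO**: for a binding world whose run flow is `genFlow β P.g₀` and whose
`IndAss k` IS `IndAOfRecordT (TcOfRecord) (chiFixed7 ν) ε β …` at the record's own objects (`Record10`'s ∕ `Record11`'s shape), `smallCouplings → smallFieldInductive`
follows from (1.1) on the domains, `HRestrict` and (1.1)-uniqueness at the intermediate levels — N07's content — and NOTHING ELSE: no composition clause, no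
invariance hypothesis, no χ-locality hypothesis, NO continuity proviso (MODULE 2 §5's `thm3Member_of_indATPlug_TcOfRecord` minus its `hex` binder).
[cite: Balaban1987RG1, Thm 3 p.264, (1.1)–(1.3) p.260, (0.13) p.254, p.263 and (2.16) p.269; Balaban1985Variational, Thm 1 p.279] -/
theorem thm3Member_of_indATPlug_TcOfRecord_unconditional
    (h11 : ∀ k, k ≤ P.K → ∀ V ∈ dom k, UkExists F N P.K k ε V ∧ UniqueUkOrbit F N P.K k ε V)
    (hres : ∀ k, k ≤ P.K → HRestrict F N ε P.K k (dom k))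
    (huniq : ∀ k, k ≤ P.K → ∀ V ∈ dom k, ∀ j < k,
      UniqueUkOrbit F N P.K (j + 1) ε (Averaging.iter (avOfRecord F N P.K) (j + 1) (Uk F N P.K k ε V))) :
    (leavesP w P).smallCouplings → (leavesP w P).smallFieldInductive :=
  thm3Member_of_indATPlug_of_steps (TcOfRecord F N) (chiFixed7 F N ν) ε β dom hflow hind
    (fun k _ => chiFixed7_extd_prefixOf ν P.K (genSeq β P.g0) k) (fun j _ => liftInvariant_chiFixed7 ν P.K _ j)
    (fun _ hk => stepInvariant_TcOfRecord_unconditional ν P.K (genSeq β P.g0) hk) h11 hres huniq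

include hflow hind in
/-- **N09 AT `(w, P)` AT THE β RE-POINT OF RECORD — NO PROVISO**: its own leaf `b12` + [B11] Thm 1 at the record's objects ⇒ `Dag.B12_main (leavesP w P)`.
[cite: Balaban1987RG1, Lemma 4 (3.53) p.280, Thm 3 p.264 and (1.1)–(1.3) p.260; Balaban1985Variational, Thm 1 p.279] -/
theorem b12_main_of_indATPlug_of_leaf_TcOfRecord_unconditional (h12 : (leavesP w P).b12)
    (h11 : ∀ k, k ≤ P.K → ∀ V ∈ dom k, UkExists F N P.K k ε V ∧ UniqueUkOrbit F N P.K k ε V)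
    (hres : ∀ k, k ≤ P.K → HRestrict F N ε P.K k (dom k))
    (huniq : ∀ k, k ≤ P.K → ∀ V ∈ dom k, ∀ j < k,
      UniqueUkOrbit F N P.K (j + 1) ε (Averaging.iter (avOfRecord F N P.K) (j + 1) (Uk F N P.K k ε V))) :
    Dag.B12_main (leavesP w P) :=
  b12_main_of_leaf_of_thm3Member h12 (thm3Member_of_indATPlug_TcOfRecord_unconditional ν ε β dom hflow hind h11 hres huniq)

end Plug

/-! ## §4. N09's member at the PROVISO-FREE Stage-10 and Stage-11 cores -/

section Core10

/-- **THE THEOREM-3 MEMBER OF N09 AT `(w, P)` FOR A WORLD BOUND TO THE STAGE-10 CORE — NO `Provisos₁₀`**: the core's construction over the densities of record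
(`datumOfRecord₁₀_C`'s right-hand side; its faces flow ∕ `IndAss` are `genFlow (betaOfRecord₁₀ θ) p.g₀` ∕ def-B's `IndAOfRecordT (TcOfRecord) (chiFixed7 θ.ν) …` by `rfl`)
gives `smallCouplings → smallFieldInductive` from (1.1) on `domAltOfRecord`, `HRestrict` and intermediate uniqueness — §3's plug; MODULE 3's
`thm3Member_stage10_of_hRestrict` read `h.contT`, this statement quantifies NO proviso. [cite: Balaban1987RG1, Thm 3 p.264, (1.1)–(1.3) p.260 and (2.16) p.269; Balaban1985Variational, Thm 1 (8)–(10) p.279] -/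
theorem thm3Member_core10_of_hRestrict (θ : Stage9Params F N) {w : WorldP}
    (hC : w.C = (coreOfRecord₁₀ F N θ).construction (densOfRecord₁₀ F N θ)) (P : B12.RunParams)
    (h11 : ∀ k, k ≤ P.K → ∀ V ∈ domAltOfRecord F N θ.ν P.K k, UkExists F N P.K k θ.εbg V ∧ UniqueUkOrbit F N P.K k θ.εbg V)
    (hres : ∀ k, k ≤ P.K → HRestrict F N θ.εbg P.K k (domAltOfRecord F N θ.ν P.K k))
    (huniq : ∀ k, k ≤ P.K → ∀ V ∈ domAltOfRecord F N θ.ν P.K k, ∀ j < k,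
      UniqueUkOrbit F N P.K (j + 1) θ.εbg (Averaging.iter (avOfRecord F N P.K) (j + 1) (Uk F N P.K k θ.εbg V))) :
    (leavesP w P).smallCouplings → (leavesP w P).smallFieldInductive :=
  thm3Member_of_indATPlug_TcOfRecord_unconditional θ.ν θ.εbg (betaOfRecord₁₀ F N θ) (fun k => domAltOfRecord F N θ.ν P.K k)
    (by rw [hC]; rfl) (fun k _ => by rw [hC]; exact Iff.rfl) h11 hres huniq

end Core10

section Core11

/-- **THE THEOREM-3 MEMBER OF N09 AT `(w, P)` FOR A WORLD BOUND TO THE STAGE-11 CORE — NO `Provisos₁₁`**: the Stage-11 core's construction over the densities of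
record of its Stage-9 part (`datumOfRecord₁₁_C`'s right-hand side — the term every Stage-11 record sets as its `C`; action side = Stage 10's verbatim) gives
`smallCouplings → smallFieldInductive` from (1.1) on `domAltOfRecord F N θ.ν`, `HRestrict` and (1.1)-uniqueness at the intermediate levels — [B11] Thm 1 at the
record's level domains, N07's content — and NOTHING of NODE 00's provisos.  Seat dag-n09-d's `B12NodeKnitRecord11.thm3Member_stage11_of_hRestrict` (world bound to
`(datumOfRecord₁₁ θ h).C`, proof through `h.base.contT`) and `thm3Member_at_record₁₁C_of_hRestrict` are its instances through `datumOfRecord₁₁_C`.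
[cite: Balaban1987RG1, Thm 3 p.264, (1.1)–(1.3) p.260, (0.21)–(0.23) p.256 and (2.16) p.269; Balaban1985Variational, Thm 1 (8)–(10) p.279] -/
theorem thm3Member_core11_of_hRestrict (θ : Stage11Params F N) {w : WorldP}
    (hC : w.C = (coreOfRecord₁₁ F N θ).construction (densOfRecord₁₀ F N θ.toStage9Params)) (P : B12.RunParams)
    (h11 : ∀ k, k ≤ P.K → ∀ V ∈ domAltOfRecord F N θ.ν P.K k, UkExists F N P.K k θ.εbg V ∧ UniqueUkOrbit F N P.K k θ.εbg V)
    (hres : ∀ k, k ≤ P.K → HRestrict F N θ.εbg P.K k (domAltOfRecord F N θ.ν P.K k))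
    (huniq : ∀ k, k ≤ P.K → ∀ V ∈ domAltOfRecord F N θ.ν P.K k, ∀ j < k,
      UniqueUkOrbit F N P.K (j + 1) θ.εbg (Averaging.iter (avOfRecord F N P.K) (j + 1) (Uk F N P.K k θ.εbg V))) :
    (leavesP w P).smallCouplings → (leavesP w P).smallFieldInductive :=
  thm3Member_of_indATPlug_TcOfRecord_unconditional θ.ν θ.εbg (betaOfRecord₁₀ F N θ.toStage9Params) (fun k => domAltOfRecord F N θ.ν P.K k)
    (by rw [hC]; rfl) (fun k _ => by rw [hC]; exact Iff.rfl) h11 hres huniq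

/-- **N09 AT `(w, P)`, Stage-11 core, from the own leaf and [B11] Thm 1 at the record's objects — NO `Provisos₁₁`.** [cite: Balaban1987RG1, Lemma 4 (3.53) p.280, Thm 3 p.264 and (1.1)–(1.3) p.260; Balaban1985Variational, Thm 1 p.279] -/
theorem b12_main_core11_of_leaf_of_hRestrict (θ : Stage11Params F N) {w : WorldP}
    (hC : w.C = (coreOfRecord₁₁ F N θ).construction (densOfRecord₁₀ F N θ.toStage9Params)) (P : B12.RunParams) (h12 : (leavesP w P).b12)
    (h11 : ∀ k, k ≤ P.K → ∀ V ∈ domAltOfRecord F N θ.ν P.K k, UkExists F N P.K k θ.εbg V ∧ UniqueUkOrbit F N P.K k θ.εbg V)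
    (hres : ∀ k, k ≤ P.K → HRestrict F N θ.εbg P.K k (domAltOfRecord F N θ.ν P.K k))
    (huniq : ∀ k, k ≤ P.K → ∀ V ∈ domAltOfRecord F N θ.ν P.K k, ∀ j < k,
      UniqueUkOrbit F N P.K (j + 1) θ.εbg (Averaging.iter (avOfRecord F N P.K) (j + 1) (Uk F N P.K k θ.εbg V))) :
    Dag.B12_main (leavesP w P) :=
  b12_main_of_leaf_of_thm3Member h12 (thm3Member_core11_of_hRestrict θ hC P h11 hres huniq)

/-- **N09 AT `(w, P)`, Stage-11 core, IS «in-edges → its own leaf `b12`»** given [B11] Thm 1 at the record's objects — NO `Provisos₁₁`.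
[cite: Balaban1987RG1, Lemma 4 (3.53) p.280 and Thm 3 p.264] -/
theorem b12_main_core11_iff_leaf_of_hRestrict (θ : Stage11Params F N) {w : WorldP}
    (hC : w.C = (coreOfRecord₁₁ F N θ).construction (densOfRecord₁₀ F N θ.toStage9Params)) (P : B12.RunParams)
    (h11 : ∀ k, k ≤ P.K → ∀ V ∈ domAltOfRecord F N θ.ν P.K k, UkExists F N P.K k θ.εbg V ∧ UniqueUkOrbit F N P.K k θ.εbg V)
    (hres : ∀ k, k ≤ P.K → HRestrict F N θ.εbg P.K k (domAltOfRecord F N θ.ν P.K k))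
    (huniq : ∀ k, k ≤ P.K → ∀ V ∈ domAltOfRecord F N θ.ν P.K k, ∀ j < k,
      UniqueUkOrbit F N P.K (j + 1) θ.εbg (Averaging.iter (avOfRecord F N P.K) (j + 1) (Uk F N P.K k θ.εbg V))) :
    Dag.B12_main (leavesP w P) ↔
      ((leavesP w P).b4 → (leavesP w P).b5 → (leavesP w P).b6 → (leavesP w P).b7 → (leavesP w P).b8 → (leavesP w P).b9 →
        (leavesP w P).b10 → (leavesP w P).b11 → (leavesP w P).b12) :=
  b12_main_iff_leaf_of_thm3Member (thm3Member_core11_of_hRestrict θ hC P h11 hres huniq)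

end Core11

/-! ## §5. Non-vacuity of the remaining binders: one-step runs in the numeric window -/

/-- **(1.1) AT LEVEL 0 ON THE DOMAIN OF RECORD, IN THE WINDOW `ν.ε₀ ≤ εbg`**: every `V ∈ domAltOfRecord F N ν K 0` (plaquettes within `ν.ε₀` of `1`) lies in the
level-`0` regularity class `bgReg F N K 0 εbg` (`η_0 = 1`), so the level-`0` problem over `V` is solvable (`ukExists_zero_iff`) and (1.1)-uniqueness holds outright
(`uniqueUkOrbit_zero`). [cite: Balaban1987RG1, (1.1)–(1.2) p.260 (the case k = 0)] -/
theorem h11_level_zero_of_window (ν : Stage7Numerics) {εbg : ℝ} (hε : ν.ε₀ ≤ εbg) (K : ℕ) :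
    ∀ V ∈ domAltOfRecord F N ν K 0, UkExists F N K 0 εbg V ∧ UniqueUkOrbit F N K 0 εbg V := by
  intro V hV
  refine ⟨?_, uniqueUkOrbit_zero V⟩
  rw [ukExists_zero_iff, mem_bgReg_iff]
  rw [mem_domAltOfRecord_iff] at hV
  have heta : (F.P K).eta 0 = 1 := by simp [Params.eta]
  intro q
  calc dist1 (GaugeField.plaqHol V q) < ν.ε₀ := hV q
    _ ≤ εbg * (F.P K).eta 0 ^ 2 := by rw [heta]; simpa using hε

/-- `HRestrict` at level `0` is vacuous (no `j < 0`). [cite: Balaban1985Variational, Thm 1 p.279 (the case k = 0; bookkeeping)] -/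
theorem hRestrict_zero (ε : ℝ) (K : ℕ) (dom : Set (GaugeField (F.P K) 0 (SU N))) : HRestrict F N ε K 0 dom :=
  fun _ _ j hj => absurd hj (Nat.not_lt_zero j)

/-- Intermediate uniqueness at level `0` is vacuous (no `j < 0`). [cite: Balaban1987RG1, (1.1) p.260 (the case k = 0; bookkeeping)] -/
theorem huniq_zero (ε : ℝ) (K : ℕ) (dom : Set (GaugeField (F.P K) 0 (SU N))) :
    ∀ V ∈ dom, ∀ j < 0, UniqueUkOrbit F N K (j + 1) ε (Averaging.iter (avOfRecord F N K) (j + 1) (Uk F N K 0 ε V)) :=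
  fun _ _ j hj => absurd hj (Nat.not_lt_zero j)

/-- **NON-VACUITY — THE MEMBER HOLDS OUTRIGHT ON EVERY ONE-STEP RUN IN THE WINDOW**: for every Stage-11 parameter `θ` with `θ.ν.ε₀ ≤ θ.εbg`, every world bound
to the Stage-11 core and every run `P` with `P.K = 0`, `smallCouplings → smallFieldInductive` with NO binder at all — the binder family `h11 ∕ hres ∕ huniq` of
`thm3Member_core11_of_hRestrict` is INHABITED at such runs (`h11_level_zero_of_window`, `hRestrict_zero`, `huniq_zero`), so §4's implication is not ex falso.
[cite: Balaban1987RG1, Thm 3 p.264 and (1.1)–(1.3) p.260 (the case K = 0)] -/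
theorem thm3Member_core11_of_K_eq_zero (θ : Stage11Params F N) (hε : θ.ν.ε₀ ≤ θ.εbg) {w : WorldP}
    (hC : w.C = (coreOfRecord₁₁ F N θ).construction (densOfRecord₁₀ F N θ.toStage9Params)) (P : B12.RunParams) (hP : P.K = 0) :
    (leavesP w P).smallCouplings → (leavesP w P).smallFieldInductive := by
  refine thm3Member_core11_of_hRestrict θ hC P ?_ ?_ ?_
  · intro k hk
    obtain rfl : k = 0 := Nat.le_zero.1 (hP ▸ hk)
    exact h11_level_zero_of_window θ.ν hε P.K
  · intro k hk
    obtain rfl : k = 0 := Nat.le_zero.1 (hP ▸ hk)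
    exact hRestrict_zero θ.εbg P.K _
  · intro k hk
    obtain rfl : k = 0 := Nat.le_zero.1 (hP ▸ hk)
    exact huniq_zero θ.εbg P.K _

end Literature.MathematicalPhysics.QuantumFieldTheory.Balaban1983to89.B12HInvUnconditional

end
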